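import Summits.CriticalPhenomena.PercolationContinuityZ3.Theorems.PercNearOneGluingNearOneGluingExch0
import HarnessLib

/-!
# Crux `PercNearOneGluing.NearOneGluing` (stmt-CriticalPhenomena-4574), line `SketchR2I5` —
# stub `stub_condDisconnTilt` (conditioning on a disconnection tilts a cluster connection up)

Lead prover-line-stmt-CriticalPhenomena-4574-c7 (cycle 7, wave 2).  Lands
`--supports stmt-CriticalPhenomena-4574`; no definitions, no named facts.

## Content

Finite weighted graph on `Fin n`, `μ = prodBernoulli w` on `Set (Sym2 (Fin n))`, `{a ↔ b} = openConn a b`,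
`C_a(ω) = openEdgeCluster ω a`.  For a finite vertex set `X`, a source `s`, and `R_X := {ω | ∀ x ∈ X, s ↮ x}`
(the open cluster of `s` avoids `X`), a test vertex `t` and a pair `u, v` with `v ∈ X`:

`μ(R_X ∩ {s↔t}) · μ(R_X ∩ {u↮v}) ≤ μ(R_X ∩ {s↔t} ∩ {u↮v}) · μ(R_X)`,

i.e. `P(s ↔ t | R_X) ≤ P(s ↔ t | R_X, u ↮ v)` with denominators cleared (`condDisconnTilt`, registered stub
form `stub_condDisconnTilt`): conditioning further on a disconnection from a vertex of `X` raises the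
conditional probability of the increasing cluster event `{s ↔ t}`.

Proof.  If `s ∈ X` then `R_X = ∅` and both sides vanish.  Otherwise `{s}` and `X` are disjoint and the
tree theorem `stub_bhkSets` (2) — van den Berg–Häggström–Kahn, Thm. 1.4, for the open edge cluster `C_s` of
the source `s` and the open edge cluster `C_X = ⋃_{x ∈ X} C_x` of the SET `X`, given `{s ↮ X} = R_X` — applied
to the increasing functions `F = 1{s ↔ t}` (read off `C_s`) and `G = 1{v ↔ u}` (read off `C_X ⊇ C_v`,
`mem_openConn_iff_of_cluster_subset`) gives
`μ(R_X) · μ(R_X ∩ {s↔t} ∩ {u↔v}) ≤ μ(R_X ∩ {s↔t}) · μ(R_X ∩ {u↔v})` (`condDisconnTilt_bhk`); the claim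
follows by `μ(A ∩ {u↮v}) = μ(A) − μ(A ∩ {u↔v})` and linear arithmetic.
[cite: VandenbergHaggstromKahn2005, Thm. 1.4 (p. 7)]
[cite: KozmaNitzan2024, §2.2 (use of BHK for the cluster of a set)]
-/

namespace Summit.CriticalPhenomena.PercolationContinuityZ3.Theorems

open MeasureTheory Set Literature.Probability.LatticeModels Literature.Probability.Percolation
open scoped Classical BigOperators
open Q7ThreeCut

noncomputable section

variable {n : ℕ}

/-! ### BHK Thm. 1.4 for the source `s` and the set `X` -/

/-- **van den Berg–Häggström–Kahn, Thm. 1.4, for the clusters of `s` and of the set `X` given `R_X = {s ↮ X}`**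
(tree theorem `stub_bhkSets` (2) with `f = 1{s↔t}` read off `C_s` and `g = 1{u↔v}`, `v ∈ X`, read off the
union edge cluster `⋃_{x∈X} C_x ⊇ C_v`): for `s ∉ X`,
`μ(R_X) · μ(R_X ∩ {s↔t} ∩ {u↔v}) ≤ μ(R_X ∩ {s↔t}) · μ(R_X ∩ {u↔v})`.
[cite: VandenbergHaggstromKahn2005, Thm. 1.4 (p. 7)] -/
theorem condDisconnTilt_bhk (w : Sym2 (Fin n) → unitInterval) (X : Finset (Fin n)) (s t u v : Fin n)
    (hv : v ∈ X) (hs : s ∉ X) :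
    (prodBernoulli w).real {ω : BondConfig (Fin n) | ∀ x ∈ X, ω ∉ (openConn s x : Set (BondConfig (Fin n)))} *
        (prodBernoulli w).real
          ({ω : BondConfig (Fin n) | ∀ x ∈ X, ω ∉ (openConn s x : Set (BondConfig (Fin n)))} ∩
            openConn s t ∩ openConn u v) ≤
      (prodBernoulli w).real
          ({ω : BondConfig (Fin n) | ∀ x ∈ X, ω ∉ (openConn s x : Set (BondConfig (Fin n)))} ∩
            openConn s t) *
        (prodBernoulli w).real
          ({ω : BondConfig (Fin n) | ∀ x ∈ X, ω ∉ (openConn s x : Set (BondConfig (Fin n)))} ∩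
            openConn u v) := by
  set R : Set (BondConfig (Fin n)) :=
    {ω : BondConfig (Fin n) | ∀ x ∈ X, ω ∉ (openConn s x : Set (BondConfig (Fin n)))} with hR
  set F : Set (Sym2 (Fin n)) → ℝ := (openConn s t : Set (BondConfig (Fin n))).indicator 1 with hF
  set G : Set (Sym2 (Fin n)) → ℝ := (openConn v u : Set (BondConfig (Fin n))).indicator 1 with hG
  have hFm : Monotone F := monotone_indicator_of_isUpperSet (isUpperSet_openConn s t)
  have hGm : Monotone G := monotone_indicator_of_isUpperSet (isUpperSet_openConn v u)
  -- the conditioning set of `stub_bhkSets` (2) for `S = {s}`, `S' = X` is `R`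
  have hD : {ω : BondConfig (Fin n) | ∀ s' ∈ ({s} : Finset (Fin n)), ∀ x ∈ X,
      ¬ (openGraph ω).Reachable s' x} = R := by
    ext ω
    simp only [mem_setOf_eq, Finset.mem_singleton, forall_eq, hR]
    rfl
  -- the clusters
  have hCs : ∀ ω : BondConfig (Fin n), (⋃ s' ∈ ({s} : Finset (Fin n)), openEdgeCluster ω s') =
      openEdgeCluster ω s := fun ω => Finset.set_biUnion_singleton s _
  -- pointwise identification of the integrands
  have eF : ∀ ω : BondConfig (Fin n), F (openEdgeCluster ω s) =
      (openConn s t : Set (BondConfig (Fin n))).indicator 1 ω := fun ω =>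
    indicator_openConn_of_cluster_subset subset_rfl (openEdgeCluster_subset ω s)
  have eG : ∀ ω : BondConfig (Fin n), G (⋃ x ∈ X, openEdgeCluster ω x) =
      (openConn u v : Set (BondConfig (Fin n))).indicator 1 ω := by
    intro ω
    have hvu : (openConn v u : Set (BondConfig (Fin n))) = openConn u v :=
      Set.ext fun _ => ⟨fun h => SimpleGraph.Reachable.symm h, fun h => SimpleGraph.Reachable.symm h⟩
    rw [hG, indicator_openConn_of_cluster_subset (Finset.subset_set_biUnion_of_mem hv)
      (Set.iUnion₂_subset fun x _ => openEdgeCluster_subset ω x), hvu]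
  have eFG : ∀ ω : BondConfig (Fin n), F (openEdgeCluster ω s) * G (⋃ x ∈ X, openEdgeCluster ω x) =
      (openConn s t ∩ openConn u v : Set (BondConfig (Fin n))).indicator 1 ω := by
    intro ω
    rw [eF, eG]
    exact (congrFun (inter_indicator_one (s := (openConn s t : Set (BondConfig (Fin n))))
      (t := openConn u v) (M₀ := ℝ)) ω).symm
  have key := stub_bhkSets.2 n w {s} X F G hFm hGm (Finset.disjoint_singleton_left.2 hs)
  simp only [hD, hCs] at key
  simp only [eFG] at key
  simp only [eF, eG, setIntegral_indicator_one_eq] at key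
  simpa only [inter_assoc] using key

/-! ### The tilt inequality -/

/-- **Conditioning on a disconnection tilts a cluster connection up.**  For `v ∈ X` and
`R_X = {ω | ∀ x ∈ X, s ↮ x}`:
`μ(R_X ∩ {s↔t}) · μ(R_X ∩ {u↮v}) ≤ μ(R_X ∩ {s↔t} ∩ {u↮v}) · μ(R_X)`, i.e.
`P(s ↔ t | R_X) ≤ P(s ↔ t | R_X, u ↮ v)` with denominators cleared.  From `condDisconnTilt_bhk`
(van den Berg–Häggström–Kahn, Thm. 1.4, source `s` versus the set `X`) by complementing `{u ↔ v}`; for `s ∈ X`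
the event `R_X` is empty. [cite: VandenbergHaggstromKahn2005, Thm. 1.4 (p. 7)] -/
theorem condDisconnTilt (w : Sym2 (Fin n) → unitInterval) (X : Finset (Fin n)) (s t u v : Fin n)
    (hv : v ∈ X) :
    (prodBernoulli w).real
          ({ω : BondConfig (Fin n) | ∀ x ∈ X, ω ∉ (openConn s x : Set (BondConfig (Fin n)))} ∩
            openConn s t) *
        (prodBernoulli w).real
          ({ω : BondConfig (Fin n) | ∀ x ∈ X, ω ∉ (openConn s x : Set (BondConfig (Fin n)))} ∩
            (openConn u v)ᶜ) ≤
      (prodBernoulli w).real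
          ({ω : BondConfig (Fin n) | ∀ x ∈ X, ω ∉ (openConn s x : Set (BondConfig (Fin n)))} ∩
            openConn s t ∩ (openConn u v)ᶜ) *
        (prodBernoulli w).real
          {ω : BondConfig (Fin n) | ∀ x ∈ X, ω ∉ (openConn s x : Set (BondConfig (Fin n)))} := by
  set μ := prodBernoulli w with hμ
  set R : Set (BondConfig (Fin n)) :=
    {ω : BondConfig (Fin n) | ∀ x ∈ X, ω ∉ (openConn s x : Set (BondConfig (Fin n)))} with hR
  by_cases hs : s ∈ X
  · -- `s ∈ X`: `R = ∅` since `s ↔ s`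
    have hRe : R = ∅ := by
      ext ω
      simp only [hR, mem_setOf_eq, mem_empty_iff_false, iff_false, not_forall, not_not]
      exact ⟨s, hs, show (openGraph ω).Reachable s s from SimpleGraph.Reachable.refl s⟩
    simp only [hRe, empty_inter, measureReal_empty, mul_zero, le_refl]
  · have key := condDisconnTilt_bhk w X s t u v hv hs
    have hmuv : MeasurableSet (openConn u v : Set (BondConfig (Fin n))) := MeasurableSet.of_discrete
    have h1 : μ.real (R ∩ (openConn u v)ᶜ) = μ.real R - μ.real (R ∩ openConn u v) := by
      have h := measureReal_inter_add_sdiff (μ := μ) (s := R) hmuv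
      rw [Set.sdiff_eq] at h
      linarith
    have h2 : μ.real (R ∩ openConn s t ∩ (openConn u v)ᶜ) =
        μ.real (R ∩ openConn s t) - μ.real (R ∩ openConn s t ∩ openConn u v) := by
      have h := measureReal_inter_add_sdiff (μ := μ) (s := R ∩ openConn s t) hmuv
      rw [Set.sdiff_eq] at h
      linarith
    rw [h1, h2]
    linear_combination key

/-! ### Registered stub form (explicit `∀ n`, fully qualified) -/

/-- Registered stub form of `condDisconnTilt` (the conditional-disconnection tilt): for `v ∈ X` and
`R_X = {ω | ∀ x ∈ X, s ↮ x}`, `μ(R_X ∩ {s↔t})·μ(R_X ∩ {u↮v}) ≤ μ(R_X ∩ {s↔t} ∩ {u↮v})·μ(R_X)`.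
[cite: VandenbergHaggstromKahn2005, Thm. 1.4 (p. 7)] -/
theorem stub_condDisconnTilt : ∀ (n : ℕ) (w : Sym2 (Fin n) → unitInterval) (X : Finset (Fin n)) (s t u v : Fin n), v ∈ X → (Literature.Probability.LatticeModels.prodBernoulli w).real ({ω : Literature.Probability.Percolation.BondConfig (Fin n) | ∀ x ∈ X, ω ∉ Literature.Probability.Percolation.openConn s x} ∩ Literature.Probability.Percolation.openConn s t) * (Literature.Probability.LatticeModels.prodBernoulli w).real ({ω : Literature.Probability.Percolation.BondConfig (Fin n) | ∀ x ∈ X, ω ∉ Literature.Probability.Percolation.openConn s x} ∩ (Literature.Probability.Percolation.openConn u v)ᶜ) ≤ (Literature.Probability.LatticeModels.prodBernoulli w).real ({ω : Literature.Probability.Percolation.BondConfig (Fin n) | ∀ x ∈ X, ω ∉ Literature.Probability.Percolation.openConn s x} ∩ Literature.Probability.Percolation.openConn s t ∩ (Literature.Probability.Percolation.openConn u v)ᶜ) * (Literature.Probability.LatticeModels.prodBernoulli w).real {ω : Literature.Probability.Percolation.BondConfig (Fin n) | ∀ x ∈ X, ω ∉ Literature.Probability.Percolation.openConn s x} :=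
  fun _ w X s t u v hv => condDisconnTilt w X s t u v hv

end

end Summit.CriticalPhenomena.PercolationContinuityZ3.Theorems
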